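import Literature.AnabelianGeometry.EtaleTheta.Discharge.Sec5EnvelopeTopologyDictionary
import Literature.AnabelianGeometry.EtaleTheta.Discharge.Sec5Prop55EtaOfSaturation
import Literature.AnabelianGeometry.EtaleTheta.Discharge.Sec5RhoKernelOfConnectedTemperoid

/-!
# [EtTh] Def. 4.1 (iii) p.313 (PDF p.87) / Prop. 5.2 (iii) p.324 (PDF p.98) / Lemma 5.8 p.331 (PDF p.105): the saturation
# binders `hD1`, `hD2`, `hdies` of the §5 carrier ARE the §5 ↔ §2 dictionary (PROOF-ONLY)

Mochizuki, *The étale theta function and its Frobenioid-theoretic manifestations*, Publ. RIMS **45** (2009)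
[cite: MochizukiEtTh2009, Def 4.1 (iii) p.313 (PDF p.87); Prop 5.2 (iii) p.324 (PDF p.98); Lem 5.8 proof p.331 (PDF p.105)].
abc-iut cell, layer L2, GAP-LEDGER rows **G-L6t23-1** (`hD1`), **G-L6t23-2** (`hD2`), **G-w5d123-1** (`hdies`); seat
abc-iut-L6-t23 (gen 5), L2-lead ROW #13-addendum R166.  PROOF-ONLY companion (no `def`, no new named fact; nothing landed is
edited) of this seat's `Discharge/Sec5RootCocycleDiesOnBN.lean` (p418773) and `Discharge/Sec5Prop55EtaOfSaturation.lean`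
(p420695).

THE POINT.  The `η`-side input of the EtTh:Prop5.5/P55-L02 closer at abc-iut-L2-t4's carrier
(`ThetaFrobenioid.exists_eta_etaTautological_ofBiKummerData`, abc-iut-w5-d123, p418694) is
`hdies : ∀ k ∈ Π^tp_Ÿ̲̲, ρ k = 1 → η₀ k = 1` ("the mod-`N` étale theta cocycle dies on `Π_{B_N} ∩ Π^tp_Ÿ̲̲`"); p418773 split it
into (D1) «`Ker ρ ∩ Π^tp_Ÿ̲̲` acts trivially on `μ_N`» (Def. 4.1 (iii)(a): the base field of `A_N` is `μ_N`-saturated) and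
(D2) «the class of `η₀` vanishes there» (Def. 4.1 (iii)(b) + Kummer theory).  Both are §5 SHADOWS of the two dictionary
hypotheses which the SAME line already carries for Lemma 5.9 (iv) / Thm. 5.10 / the leaf `hKR` (abc-iut-L2-t11,
`Sec5KummerRootEquivariance.lean`):
* (D1) ⟸ abc-iut-L2-t4's **`CyclotomicCharacterCompat`** (F-1307; a fortiori abc-iut-L2-t11's `CyclotomicCharacterCompatX`,
  F-1306) — "`Π^tp_Y` [i.e., `G_K` …] acts [on `μ_N(B_N)`] via multiplication by" the cyclotomic character (Lemma 5.8 proof,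
  p.331): at `g ∈ Ker ρ`, `s^⊓-gp_N(ρ g) = 1` conjugates `μ_N(B_N)` trivially, so the dictionary reads "`χ(aug(ι g))` fixes
  `m(μ_N(B_N)) = μ_N`", i.e. `χ(aug(ι g)) = 1` (`m` is onto).  In print this IS clause (a): the Galois group of the `N`-codomain
  `B_N^bs = A_N^bs` fixes `μ_N(B_N) ≅ ℤ/Nℤ`, i.e. `K_{A_N} ⊇ μ_N`.
* `hdies`, ON THE NOSE ⟸ abc-iut-L2-t11's **`ThetaSectionCompat … η₀`** (F-0521, Prop. 5.2 (iii): the bi-Kummer difference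
  cocycle `d(h) = s^⊔-gp_N(ρ h) · s^⊓-gp_N(ρ h)⁻¹` IS `η₀⁻¹` through `m`): `d` factors through `ρ`, so at `ρ k = 1` it is `1`,
  hence `η₀(ι k) = 1` — no saturation clause, no bi-theta isomorphism (abc-iut-w4-d042's `Sec5EtaDiesOfBiTheta.lean` derives
  the same through the isomorphism of Lemma 5.9 (iv)); (D2) for `η₀` follows with the coboundary of `c := 1`.  By abc-iut-f-116's
  `thetaSectionCompat_iff` the dictionary DETERMINES `η₀`, so the honest residual of the `η`-side is exactly
  «the transported difference cocycle lies in the class `η̲̈^Θ` mod `N`» (`exists_thetaSectionCompat_mem_iff`) — the printed content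
  of Prop. 5.2 (iii).
THEOREMS.  Generic (any `𝔉 : ThetaFrobenioid`, `T`, `ι`, `m`): `diffCocycle_eq_one_of_rho_eq_one`,
`chi_aug_iota_eq_one_of_rho_eq_one_of_compat(X)`, `eta_apply_iota_eq_one_of_rho_eq_one_of_thetaSectionCompat`,
`eta_eq_one_of_rho_symm_eq_one_of_thetaSectionCompat`, `eta_apply_iota_eq_coboundary_one_of_thetaSectionCompat`;
at abc-iut-L2-t4's assembled data `ofBiKummerData` (`ι := id`) the binders VERBATIM: `hD1_ofBiKummerData_of_compat(X)`,
`hdies_ofBiKummerData_of_thetaSectionCompat`, `hD2_ofBiKummerData_of_thetaSectionCompat`, and the P55-L02 closer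
`exists_eta_etaTautological_ofBiKummerData_of_dictionary` (= p418694 with `hdies` DISCHARGED from the dictionary); at the GENUINE
connected base `B^temp(Π^tp_X)⁰` (abc-iut-L2-t4's `ofConnectedTemperoidData`, `Ker ρ = ιX⁻¹(N_{A_N})` by p428411):
`chi_aug_eq_one_of_fixes_AN_of_compatX` («the stabiliser of `A_N^bs` acts trivially on `μ_N`») and
`eta_eq_one_of_fixes_AN_of_thetaSectionCompat`, `hdies_ofConnectedTemperoidData_of_thetaSectionCompat`.
HONEST FRAMING: kernel-checked implications between typed statements; the dictionary binders remain hypotheses to be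
instantiated at the genuine data (producer of F-1306: abc-iut-L2-t11's `cyclotomicCharacterCompatX_of_galoisDictionary` from the
Galois dictionary of the constants, Lemma 5.8); nothing of [EtTh] is asserted unconditionally; typed ≠ proved; no side is taken
on anything downstream ([IUTchIII] Cor. 3.12).
-/

noncomputable section

namespace Literature.AnabelianGeometry.EtaleTheta

open CategoryTheory Opposite FrobenioidCyclotomicRigidity Literature.AlgebraicGeometry.Frobenioids
  Literature.AnabelianGeometry.SemiGraphs Literature.AnabelianGeometry.SemiGraphs.GaloisObjects

universe w v v' u u'

namespace ThetaFrobenioid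

/-! ### Generic: any §5 datum `𝔉` against any §2 datum `T` -/

section Generic

variable {C : Type u} [Category.{v} C] {D : Type u'} [Category.{v'} D] (𝔉 : ThetaFrobenioid.{w} C D)
  (T : ThetaEnvData.{v} 𝔉.N) (ι : 𝔉.PiX ≃* T.PiX) (m : 𝔉.muTorsion 𝔉.BN 𝔉.N ≃* T.mu)

/-- On `Ker ρ ∩ Π^tp_Ÿ̲` the `H_{B_N}`-valued restriction `ρ|_{Π^tp_Ÿ̲}` is trivial (tautology of the carrier: `H_{B_N} = ρ(Π^tp_Ÿ̲)`,
§5 p.331).  [cite: MochizukiEtTh2009, §5 p.331 (PDF p.105)] -/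
theorem rhoYdd_eq_one_of_rho_eq_one (k : 𝔉.PiYdd) (hk : 𝔉.ρ (k : 𝔉.PiX) = 1) : 𝔉.rhoYdd k = 1 :=
  Subtype.ext hk

/-- **The bi-Kummer difference cocycle dies on `Ker ρ ∩ Π^tp_Ÿ̲`**: `d(k) = s^⊔-gp_N(ρ k) · s^⊓-gp_N(ρ k)⁻¹ = 1` for `ρ k = 1`
— the difference cocycle of Prop. 5.2 (iii) is, by construction, a cocycle of the QUOTIENT `H_{B_N} = ρ(Π^tp_Ÿ̲)`.
[cite: MochizukiEtTh2009, Prop 5.2 (iii) p.324 (PDF p.98); §5 p.331 (PDF p.105)] -/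
theorem diffCocycle_eq_one_of_rho_eq_one (H : 𝔉.Facts) (k : 𝔉.PiYdd) (hk : 𝔉.ρ (k : 𝔉.PiX) = 1) :
    𝔉.diffCocycle H k = 1 := by
  have h1 : 𝔉.rhoYdd k = 1 := Subtype.ext hk
  have hcup : 𝔉.sgpCup (𝔉.rhoYdd k) = 1 := by
    rw [h1]
    exact map_one _
  have hcap : 𝔉.sgpCap (𝔉.rhoYdd k : Aut (𝔉.base.obj 𝔉.BN)) = 1 := by
    change 𝔉.sgpCap (𝔉.ρ k) = 1
    rw [hk, map_one]
  apply Subtype.ext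
  change 𝔉.sgpCup (𝔉.rhoYdd k) * (𝔉.sgpCap (𝔉.rhoYdd k : Aut (𝔉.base.obj 𝔉.BN)))⁻¹ = 1
  rw [hcup, hcap, inv_one, mul_one]

/-- **(D1) FROM THE `Π^tp_Y̲`-DICTIONARY** (abc-iut-L2-t4's `CyclotomicCharacterCompat`, F-1307: "`Π^tp_Y` [i.e., `G_K` …] acts
[on `μ_N(B_N)`] via multiplication by" `χ`, Lemma 5.8 proof p.331): every `g ∈ Π^tp_Y̲` with `ρ g = 1` acts TRIVIALLY on `μ_N`
through `χ ∘ aug ∘ ι` — at such `g` conjugation by `s^⊓-gp_N(ρ g) = 1` fixes `μ_N(B_N)`, so `χ(aug(ι g))` fixes `m(μ_N(B_N)) = μ_N`.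
In print: the base field of the `N`-codomain contains `μ_N` (Def. 4.1 (iii)(a) for `A_N`, `A_N^bs = B_N^bs`).
[cite: MochizukiEtTh2009, Lem 5.8 proof p.331 (PDF p.105); Def 4.1 (iii) p.313 (PDF p.87)] -/
theorem chi_aug_iota_eq_one_of_rho_eq_one_of_compat (hχ : 𝔉.CyclotomicCharacterCompat T ι m) (g : 𝔉.PiX)
    (hgY : g ∈ 𝔉.PiY) (hg : 𝔉.ρ g = 1) : T.chi (T.aug (ι g)) = 1 := by
  apply MulEquiv.ext
  intro c
  obtain ⟨u, rfl⟩ := m.surjective c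
  have h := hχ g hgY u u (by rw [hg, map_one, inv_one, one_mul, mul_one])
  rw [MulAut.one_apply]
  exact h.symm

/-- **(D1) on all of `Ker ρ` FROM THE `Π^tp_X̲`-DICTIONARY** (abc-iut-L2-t11's `CyclotomicCharacterCompatX`, F-1306): every
`g ∈ Π^tp_X̲` with `ρ g = 1` acts trivially on `μ_N` through `χ ∘ aug ∘ ι`.
[cite: MochizukiEtTh2009, Lem 5.8 proof p.331 (PDF p.105); Def 4.1 (iii) p.313 (PDF p.87)] -/
theorem chi_aug_iota_eq_one_of_rho_eq_one_of_compatX (hχX : 𝔉.CyclotomicCharacterCompatX T ι m) (g : 𝔉.PiX)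
    (hg : 𝔉.ρ g = 1) : T.chi (T.aug (ι g)) = 1 := by
  apply MulEquiv.ext
  intro c
  obtain ⟨u, rfl⟩ := m.surjective c
  have h := hχX g u u (by rw [hg, map_one, inv_one, one_mul, mul_one])
  rw [MulAut.one_apply]
  exact h.symm

/-- (D1) on `Ker ρ ∩ Π^tp_Ÿ̲` from the `Π^tp_Y̲`-dictionary (`Π^tp_Ÿ̲ ≤ Π^tp_Y̲ = Ker(Π^tp_X̲ ↠ l·ℤ)`).
[cite: MochizukiEtTh2009, Lem 5.8 proof p.331 (PDF p.105); Def 4.1 (iii) p.313 (PDF p.87)] -/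
theorem chi_aug_iota_eq_one_of_rho_eq_one_of_compat_PiYdd (hχ : 𝔉.CyclotomicCharacterCompat T ι m) (k : 𝔉.PiYdd)
    (hk : 𝔉.ρ (k : 𝔉.PiX) = 1) : T.chi (T.aug (ι k)) = 1 :=
  𝔉.chi_aug_iota_eq_one_of_rho_eq_one_of_compat T ι m hχ k (𝔉.PiYdd_le k.2) hk

/-- **`hdies` ON THE NOSE FROM THE Prop. 5.2 (iii) DICTIONARY** (abc-iut-L2-t11's `ThetaSectionCompat`, F-0521: through `m` and
`ι|Π^tp_Ÿ̲`, the bi-Kummer difference cocycle IS `η⁻¹`): for `k ∈ Π^tp_Ÿ̲` with `ρ k = 1`, `η(ι k) = 1` — no saturation clause,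
no bi-theta isomorphism.  [cite: MochizukiEtTh2009, Prop 5.2 (iii) p.324 (PDF p.98); §5 p.331 (PDF p.105)] -/
theorem eta_apply_iota_eq_one_of_rho_eq_one_of_thetaSectionCompat (H : 𝔉.Facts) (hYdd : 𝔉.IdentifiesPiYdd T ι)
    {η : T.PiYdd → T.mu} (hcompat : 𝔉.ThetaSectionCompat H T ι m hYdd η) (k : 𝔉.PiYdd)
    (hk : 𝔉.ρ (k : 𝔉.PiX) = 1) : η ⟨ι k, (hYdd k).mp k.2⟩ = 1 := by
  have h := hcompat k
  rw [𝔉.diffCocycle_eq_one_of_rho_eq_one H k hk, map_one] at h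
  exact inv_eq_one.mp h.symm

/-- **`hdies` in the `Π^tp_Ÿ`-parametrisation**: for `k ∈ Π^tp_Ÿ` with `ρ(ι⁻¹ k) = 1`, `η k = 1` (abc-iut-f-116's solved form
`thetaSectionCompat_iff`: `η k = m(d(ι⁻¹ k))⁻¹`).  [cite: MochizukiEtTh2009, Prop 5.2 (iii) p.324 (PDF p.98); §5 p.331 (PDF p.105)] -/
theorem eta_eq_one_of_rho_symm_eq_one_of_thetaSectionCompat (H : 𝔉.Facts) (hYdd : 𝔉.IdentifiesPiYdd T ι)
    {η : T.PiYdd → T.mu} (hcompat : 𝔉.ThetaSectionCompat H T ι m hYdd η) (k : T.PiYdd)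
    (hk : 𝔉.ρ (ι.symm (k : T.PiX)) = 1) : η k = 1 := by
  rw [(𝔉.thetaSectionCompat_iff H T ι m hYdd η).mp hcompat k,
    𝔉.diffCocycle_eq_one_of_rho_eq_one H ⟨ι.symm (k : T.PiX), hYdd.symm_mem 𝔉 k⟩ hk, map_one, inv_one]

/-- **(D2) for `η` with the trivial coboundary**: on `ι(Ker ρ ∩ Π^tp_Ÿ̲)`, `η` coincides with the coboundary `δ_1` (both are `1`).
[cite: MochizukiEtTh2009, Prop 5.2 (iii) p.324 (PDF p.98); Def 2.13 p.273 (PDF p.47)] -/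
theorem eta_apply_iota_eq_coboundary_one_of_thetaSectionCompat (H : 𝔉.Facts) (hYdd : 𝔉.IdentifiesPiYdd T ι)
    {η : T.PiYdd → T.mu} (hcompat : 𝔉.ThetaSectionCompat H T ι m hYdd η) (k : 𝔉.PiYdd)
    (hk : 𝔉.ρ (k : 𝔉.PiX) = 1) :
    η ⟨ι k, (hYdd k).mp k.2⟩ = CycEnvelope.coboundary (T.aug.comp T.PiYdd.subtype) T.chi 1 ⟨ι k, (hYdd k).mp k.2⟩ := by
  rw [𝔉.eta_apply_iota_eq_one_of_rho_eq_one_of_thetaSectionCompat T ι m H hYdd hcompat k hk, CycEnvelope.coboundary,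
    map_one, inv_one, mul_one]

/-- **Both inputs of `ThetaEnvData.dies_on_ker_of` for the dictionary's `η`, jointly**: (D1) from the `Π^tp_Y̲`-dictionary and
(D2) for `η` from the Prop. 5.2 (iii) dictionary — so this seat's p418773 reduction `hdies ⟸ (D1) ∧ (D2)` and the direct route
`eta_apply_iota_eq_one_of_rho_eq_one_of_thetaSectionCompat` agree.
[cite: MochizukiEtTh2009, Def 4.1 (iii) p.313 (PDF p.87); Prop 5.2 (iii) p.324 (PDF p.98)] -/
theorem d1_and_d2_of_dictionary (H : 𝔉.Facts) (hYdd : 𝔉.IdentifiesPiYdd T ι) (hχ : 𝔉.CyclotomicCharacterCompat T ι m)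
    {η : T.PiYdd → T.mu} (hcompat : 𝔉.ThetaSectionCompat H T ι m hYdd η) :
    (∀ k : 𝔉.PiYdd, 𝔉.ρ (k : 𝔉.PiX) = 1 → T.chi (T.aug (ι k)) = 1) ∧
      ∃ c : T.mu, ∀ k : 𝔉.PiYdd, 𝔉.ρ (k : 𝔉.PiX) = 1 →
        η ⟨ι k, (hYdd k).mp k.2⟩ = CycEnvelope.coboundary (T.aug.comp T.PiYdd.subtype) T.chi c ⟨ι k, (hYdd k).mp k.2⟩ :=
  ⟨fun k hk => 𝔉.chi_aug_iota_eq_one_of_rho_eq_one_of_compat_PiYdd T ι m hχ k hk,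
    ⟨1, fun k hk => 𝔉.eta_apply_iota_eq_coboundary_one_of_thetaSectionCompat T ι m H hYdd hcompat k hk⟩⟩

end Generic

/-! ### At abc-iut-L2-t4's assembled data `ofBiKummerData`: GAP rows G-L6t23-1 / G-L6t23-2 / G-w5d123-1 from the dictionary -/

section OfBiKummerData

universe u₀ v₀ u₁ v₁ w₁

variable {K : Type u₀} [Field K] {X : SemiGraphs.TemperedArithmeticGroup.{u₀} K} {D₀ : Type u₀} [Category.{v₀} D₀]
  {V : FrdIMonoidStub.{w₁}} {T₀ : RealifiedDivisorMonoids (D₀ := D₀) V} {D : Type u₁} [Category.{v₁} D]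
  {VD : FrdICatStub.{u₁, v₁, w₁} D} {S : BiKummerSetting X T₀ D VD}
  {pullFrac : ∀ {A A' : S.C} (_ : A' ⟶ A), S.biratUnits A → S.biratUnits A'}
  {lv N : ℕ+} {l' : ℕ} {RD : RigidData.{max v₁ w₁} N l'} {θ : S.biratUnits S.Aodot} {Bl : S.C}
  {Pl : S.FractionPair θ Bl} {Rl : S.NthRoot θ Pl lv pullFrac}
  (h : ModelFrobenioid.Hypotheses S.tf.divisorMonoid S.tf.ratFnFunctor)
  (toB : ∀ A : S.C, S.biratUnits A →* S.tf.biratUnitsModel A) (Q : FrobenioidTheta.ThetaSubquotientStub.{w₁} D)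
  (odd_l : Odd (lv : ℕ)) (R : S.NthRoot Rl.root Rl.pair N pullFrac) (ιX : RD.PiX ≃ₜ* X.Pi)
  (hopen : IsOpen ((S.galoisSurj R.AN.base R.αData.isGalois).ker : Set X.Pi)) (σ : Aut R.AN.base →* Aut R.AN)
  (K' : Type w₁) [Field K'] (constEmb : K'ˣ →* S.tf.biratUnitsModel R.BN)
  (constEmb_injective : Function.Injective constEmb)
  (hdivc : ∀ g : Aut R.BN.base,
    ModelFrobenioid.div ((σ ((BiKummerSetting.NthRoot.baseIso S R).conjAut.symm g)).hom ≫ R.pair.num) =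
      ModelFrobenioid.div R.pair.num)
  (hdivp : ∀ y : RD.PiYdd,
    ModelFrobenioid.div ((σ (S.galoisSurj R.AN.base R.αData.isGalois (ιX y.1))).hom ≫ R.pair.den) =
      ModelFrobenioid.div R.pair.den)

/-- **GAP row G-L6t23-1 (`hD1`) VERBATIM, from the `Π^tp_Y̲`-dictionary at the data**: `Ker ρ ∩ Π^tp_Ÿ̲̲` acts trivially on
`μ_N` — the binder `hD1` of this seat's `ThetaEnvData.dies_on_ker_of (rhoOfBiKummerData R ιX)` /
`exists_eta_etaTautological_ofBiKummerData_of_saturation`, given abc-iut-L2-t4's `CyclotomicCharacterCompat` for the §2 datum `RD`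
itself (`ι := id`).  [cite: MochizukiEtTh2009, Def 4.1 (iii) p.313 (PDF p.87); Lem 5.8 proof p.331 (PDF p.105)] -/
theorem hD1_ofBiKummerData_of_compat
    (m : (ofBiKummerData h toB Q odd_l R ιX hopen σ K' constEmb constEmb_injective hdivc hdivp).muTorsion
        (ofBiKummerData h toB Q odd_l R ιX hopen σ K' constEmb constEmb_injective hdivc hdivp).BN
        (ofBiKummerData h toB Q odd_l R ιX hopen σ K' constEmb constEmb_injective hdivc hdivp).N ≃* RD.mu)
    (hχ : (ofBiKummerData h toB Q odd_l R ιX hopen σ K' constEmb constEmb_injective hdivc hdivp).CyclotomicCharacterCompat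
      RD.toThetaEnvData (MulEquiv.refl _) m) :
    ∀ k : RD.PiYdd, rhoOfBiKummerData R ιX (k : RD.PiX) = 1 → RD.chi (RD.aug (k : RD.PiX)) = 1 :=
  fun k hk =>
    (ofBiKummerData h toB Q odd_l R ιX hopen σ K' constEmb constEmb_injective hdivc
      hdivp).chi_aug_iota_eq_one_of_rho_eq_one_of_compat_PiYdd RD.toThetaEnvData (MulEquiv.refl _) m hχ k hk

/-- **(D1) on ALL of `Ker ρ` at the data**, from abc-iut-L2-t11's `Π^tp_X̲`-dictionary: every `g ∈ Π^tp_X̲̲` with `ρ g = 1` acts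
trivially on `μ_N`.  [cite: MochizukiEtTh2009, Def 4.1 (iii) p.313 (PDF p.87); Lem 5.8 proof p.331 (PDF p.105)] -/
theorem hD1_ofBiKummerData_of_compatX
    (m : (ofBiKummerData h toB Q odd_l R ιX hopen σ K' constEmb constEmb_injective hdivc hdivp).muTorsion
        (ofBiKummerData h toB Q odd_l R ιX hopen σ K' constEmb constEmb_injective hdivc hdivp).BN
        (ofBiKummerData h toB Q odd_l R ιX hopen σ K' constEmb constEmb_injective hdivc hdivp).N ≃* RD.mu)
    (hχX : (ofBiKummerData h toB Q odd_l R ιX hopen σ K' constEmb constEmb_injective hdivc hdivp).CyclotomicCharacterCompatX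
      RD.toThetaEnvData (MulEquiv.refl _) m) :
    ∀ g : RD.PiX, rhoOfBiKummerData R ιX g = 1 → RD.chi (RD.aug g) = 1 :=
  fun g hg =>
    (ofBiKummerData h toB Q odd_l R ιX hopen σ K' constEmb constEmb_injective hdivc
      hdivp).chi_aug_iota_eq_one_of_rho_eq_one_of_compatX RD.toThetaEnvData (MulEquiv.refl _) m hχX g hg

/-- **GAP row G-w5d123-1 (`hdies`) VERBATIM, from the Prop. 5.2 (iii) dictionary at the data**: the mod-`N` theta cocycle `η₀`
of the dictionary DIES on `Ker ρ ∩ Π^tp_Ÿ̲̲` — the binder `hdies` of abc-iut-w5-d123's `exists_eta_etaTautological_ofBiKummerData`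
(p418694), of abc-iut-w5-d020's `cyclotomicRigidity_ofBiKummerData_of_laws` (p420788) and of the consolidated closer
`exists_rigidityFamily_unique_preserved_ofBiKummerData_of_leaves` (p428546), given ONLY `ThetaSectionCompat … η₀`.
[cite: MochizukiEtTh2009, Prop 5.2 (iii) p.324 (PDF p.98); §5 p.331 (PDF p.105)] -/
theorem hdies_ofBiKummerData_of_thetaSectionCompat
    (H : (ofBiKummerData h toB Q odd_l R ιX hopen σ K' constEmb constEmb_injective hdivc hdivp).Facts)
    (m : (ofBiKummerData h toB Q odd_l R ιX hopen σ K' constEmb constEmb_injective hdivc hdivp).muTorsion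
        (ofBiKummerData h toB Q odd_l R ιX hopen σ K' constEmb constEmb_injective hdivc hdivp).BN
        (ofBiKummerData h toB Q odd_l R ιX hopen σ K' constEmb constEmb_injective hdivc hdivp).N ≃* RD.mu)
    (hYdd : (ofBiKummerData h toB Q odd_l R ιX hopen σ K' constEmb constEmb_injective hdivc hdivp).IdentifiesPiYdd
      RD.toThetaEnvData (MulEquiv.refl _))
    {η₀ : RD.PiYdd → RD.mu}
    (hcompat : (ofBiKummerData h toB Q odd_l R ιX hopen σ K' constEmb constEmb_injective hdivc hdivp).ThetaSectionCompat H
      RD.toThetaEnvData (MulEquiv.refl _) m hYdd η₀) :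
    ∀ k : RD.PiYdd, rhoOfBiKummerData R ιX k = 1 → η₀ k = 1 := by
  intro k hk
  exact (ofBiKummerData h toB Q odd_l R ιX hopen σ K' constEmb constEmb_injective hdivc
    hdivp).eta_eq_one_of_rho_symm_eq_one_of_thetaSectionCompat RD.toThetaEnvData (MulEquiv.refl _) m H hYdd hcompat k hk

/-- **GAP row G-L6t23-2 (`hD2`) for the dictionary's `η₀`, from the Prop. 5.2 (iii) dictionary at the data**: on `Ker ρ ∩ Π^tp_Ÿ̲̲`
the cocycle `η₀` IS a coboundary (the trivial one) — the `η₀`-instance of the binder `hD2` of `ThetaEnvData.dies_on_ker_of`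
(the `∀ η ∈ thetaCocycles`-form of that binder, i.e. for the other members of the `l·ℤ × μ₂`-orbit, is NOT claimed here and is not
what the P55-L02 consumers use).  [cite: MochizukiEtTh2009, Def 4.1 (iii) p.313 (PDF p.87); Prop 5.2 (iii) p.324 (PDF p.98)] -/
theorem hD2_ofBiKummerData_of_thetaSectionCompat
    (H : (ofBiKummerData h toB Q odd_l R ιX hopen σ K' constEmb constEmb_injective hdivc hdivp).Facts)
    (m : (ofBiKummerData h toB Q odd_l R ιX hopen σ K' constEmb constEmb_injective hdivc hdivp).muTorsion
        (ofBiKummerData h toB Q odd_l R ιX hopen σ K' constEmb constEmb_injective hdivc hdivp).BN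
        (ofBiKummerData h toB Q odd_l R ιX hopen σ K' constEmb constEmb_injective hdivc hdivp).N ≃* RD.mu)
    (hYdd : (ofBiKummerData h toB Q odd_l R ιX hopen σ K' constEmb constEmb_injective hdivc hdivp).IdentifiesPiYdd
      RD.toThetaEnvData (MulEquiv.refl _))
    {η₀ : RD.PiYdd → RD.mu}
    (hcompat : (ofBiKummerData h toB Q odd_l R ιX hopen σ K' constEmb constEmb_injective hdivc hdivp).ThetaSectionCompat H
      RD.toThetaEnvData (MulEquiv.refl _) m hYdd η₀) :
    ∃ c : RD.mu, ∀ k : RD.PiYdd, rhoOfBiKummerData R ιX (k : RD.PiX) = 1 →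
      η₀ k = CycEnvelope.coboundary (RD.aug.comp RD.PiYdd.subtype) RD.chi c k := by
  refine ⟨1, fun k hk => ?_⟩
  rw [hdies_ofBiKummerData_of_thetaSectionCompat h toB Q odd_l R ιX hopen σ K' constEmb constEmb_injective hdivc hdivp H m hYdd
    hcompat k hk, CycEnvelope.coboundary, map_one, inv_one, mul_one]

/-- **EtTh:Prop5.5/P55-L02 at the carrier, `η`-side FROM THE DICTIONARY** (abc-iut-w5-d123's closer p418694 with its binder `hdies`
DISCHARGED by `hdies_ofBiKummerData_of_thetaSectionCompat`): for the §5 data `𝔉 := ofBiKummerData …` over a §2 `RigidData RD` and a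
mod-`N` theta cocycle `η₀` of the class satisfying the Prop. 5.2 (iii) dictionary, IF the subquotient datum `P` satisfies the row-2
laws `hlift`, `hP`, THEN there is an `η : H_{B_N} → (l·Δ_Θ)_{B_N} ⊗ ℤ/Nℤ` descending `η₀` through `e` which is tautological on the
`(l·Δ_Θ)_{B_N}`-part: `EtaTautological 𝔉 P η`.  Trust base on the `η`-side = {`η₀ ∈ thetaCocycles`, `ThetaSectionCompat … η₀`} —
by abc-iut-f-116's `exists_thetaSectionCompat_mem_iff` exactly «the transported bi-Kummer difference cocycle lies in `η̲̈^Θ` mod `N`»,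
the printed content of Prop. 5.2 (iii); no saturation binder, no bi-theta isomorphism.
[cite: MochizukiEtTh2009, Prop 5.5 proof p.327 (PDF p.101); Prop 5.2 (iii) p.324 (PDF p.98)] -/
theorem exists_eta_etaTautological_ofBiKummerData_of_dictionary
    (H : (ofBiKummerData h toB Q odd_l R ιX hopen σ K' constEmb constEmb_injective hdivc hdivp).Facts)
    (m : (ofBiKummerData h toB Q odd_l R ιX hopen σ K' constEmb constEmb_injective hdivc hdivp).muTorsion
        (ofBiKummerData h toB Q odd_l R ιX hopen σ K' constEmb constEmb_injective hdivc hdivp).BN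
        (ofBiKummerData h toB Q odd_l R ιX hopen σ K' constEmb constEmb_injective hdivc hdivp).N ≃* RD.mu)
    (hYdd : (ofBiKummerData h toB Q odd_l R ιX hopen σ K' constEmb constEmb_injective hdivc hdivp).IdentifiesPiYdd
      RD.toThetaEnvData (MulEquiv.refl _))
    {η₀ : RD.PiYdd → RD.mu} (hη₀ : η₀ ∈ RD.thetaCocycles)
    (hcompat : (ofBiKummerData h toB Q odd_l R ιX hopen σ K' constEmb constEmb_injective hdivc hdivp).ThetaSectionCompat H
      RD.toThetaEnvData (MulEquiv.refl _) m hYdd η₀)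
    (e : RD.mu → (ofBiKummerData h toB Q odd_l R ιX hopen σ K' constEmb constEmb_injective hdivc hdivp).lDeltaModN
      (ofBiKummerData h toB Q odd_l R ιX hopen σ K' constEmb constEmb_injective hdivc hdivp).BN)
    (P : ThetaSubquotientProj (ofBiKummerData h toB Q odd_l R ιX hopen σ K' constEmb constEmb_injective hdivc hdivp))
    (hlift : ∀ a ∈ (ofBiKummerData h toB Q odd_l R ιX hopen σ K' constEmb constEmb_injective hdivc hdivp).HB,
      a ∈ P.pre _ → ∃ k : RD.PiYdd, (k : RD.PiX) ∈ RD.lDeltaTheta ∧ rhoOfBiKummerData R ιX k = a)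
    (hP : ∀ (k : RD.PiYdd) (hk : (k : RD.PiX) ∈ RD.lDeltaTheta) (hm : rhoOfBiKummerData R ιX k ∈ P.pre _),
      (QuotientGroup.mk (P.proj _ ⟨rhoOfBiKummerData R ιX k, hm⟩) :
          (ofBiKummerData h toB Q odd_l R ιX hopen σ K' constEmb constEmb_injective hdivc hdivp).lDeltaModN
            (ofBiKummerData h toB Q odd_l R ιX hopen σ K' constEmb constEmb_injective hdivc hdivp).BN) =
        e (RD.thetaMod ⟨k, hk⟩)) :
    ∃ η : (ofBiKummerData h toB Q odd_l R ιX hopen σ K' constEmb constEmb_injective hdivc hdivp).HB →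
        (ofBiKummerData h toB Q odd_l R ιX hopen σ K' constEmb constEmb_injective hdivc hdivp).lDeltaModN
          (ofBiKummerData h toB Q odd_l R ιX hopen σ K' constEmb constEmb_injective hdivc hdivp).BN,
      (∀ k : RD.PiYdd, η ⟨rhoOfBiKummerData R ιX k, Subgroup.mem_map_of_mem _ k.2⟩ = e (η₀ k)) ∧
      Thm56Sub.EtaTautological (ofBiKummerData h toB Q odd_l R ιX hopen σ K' constEmb constEmb_injective hdivc hdivp)
        P η :=
  exists_eta_etaTautological_ofBiKummerData h toB Q odd_l R ιX hopen σ K' constEmb constEmb_injective hdivc hdivp hη₀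
    (hdies_ofBiKummerData_of_thetaSectionCompat h toB Q odd_l R ιX hopen σ K' constEmb constEmb_injective hdivc hdivp H m hYdd
      hcompat) e P hlift hP

end OfBiKummerData

/-! ### At the GENUINE connected base `B^temp(Π^tp_X)⁰` (abc-iut-L2-t4's `ofConnectedTemperoidData`): the stabiliser form -/

section Connected

universe u₀ v₀ w₁

variable {K : Type u₀} [Field K] {X : SemiGraphs.TemperedArithmeticGroup.{u₀} K} {D₀ : Type u₀} [Category.{v₀} D₀]
  {V : FrdIMonoidStub.{w₁}} {T₀ : RealifiedDivisorMonoids (D₀ := D₀) V}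
  {VD : FrdICatStub.{u₀ + 1, u₀, w₁} (ConnectedPart (BTemp X.Pi))}
  {tf : TemperedFrobenioid T₀ (ConnectedPart (BTemp X.Pi)) VD} {hZ : tf.monoidType = MonoidType.Z}
  {hP : ∀ A : (ConnectedPart (BTemp X.Pi))ᵒᵖ, IsPerfect (tf.Φ.carrier A)}
  {NH : Subgroup (Field.absoluteGaloisGroup K) → tf.category → ℕ+ → Prop} {A₀ : tf.category}
  {hA₀ : PreFrobenioid.IsFrobeniusTrivial tf.toElem A₀} {hA₀' : SemiGraphs.IsGaloisObj A₀.base.obj}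
  {pullFrac : ∀ {A A' : (BiKummerSetting.mkOfConnectedTemperoid X tf hZ hP NH A₀ hA₀ hA₀').C} (_ : A' ⟶ A),
    (BiKummerSetting.mkOfConnectedTemperoid X tf hZ hP NH A₀ hA₀ hA₀').biratUnits A →
      (BiKummerSetting.mkOfConnectedTemperoid X tf hZ hP NH A₀ hA₀ hA₀').biratUnits A'}
  {lv : ℕ+}
  {θ : (BiKummerSetting.mkOfConnectedTemperoid X tf hZ hP NH A₀ hA₀ hA₀').biratUnits
    (BiKummerSetting.mkOfConnectedTemperoid X tf hZ hP NH A₀ hA₀ hA₀').Aodot}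
  {Bl : (BiKummerSetting.mkOfConnectedTemperoid X tf hZ hP NH A₀ hA₀ hA₀').C}
  {Pl : (BiKummerSetting.mkOfConnectedTemperoid X tf hZ hP NH A₀ hA₀ hA₀').FractionPair θ Bl}
  {Rl : (BiKummerSetting.mkOfConnectedTemperoid X tf hZ hP NH A₀ hA₀ hA₀').NthRoot θ Pl lv pullFrac}
  {N : ℕ+} {l' : ℕ} {RD : RigidData.{max u₀ w₁} N l'}
  (h : ModelFrobenioid.Hypotheses tf.divisorMonoid tf.ratFnFunctor)
  (Q : FrobenioidTheta.ThetaSubquotientStub.{w₁} (ConnectedPart (BTemp X.Pi))) (odd_l : Odd (lv : ℕ))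
  (R : (BiKummerSetting.mkOfConnectedTemperoid X tf hZ hP NH A₀ hA₀ hA₀').NthRoot Rl.root Rl.pair N pullFrac)
  (ιX : RD.PiX ≃ₜ* X.Pi) (K' : Type w₁) [Field K'] (constEmb : K'ˣ →* tf.biratUnitsModel R.BN)
  (constEmb_injective : Function.Injective constEmb)
  (hinvc : ∀ g : Aut R.AN.base,
    pull tf.divisorMonoid g.hom (ModelFrobenioid.div R.pair.num) = ModelFrobenioid.div R.pair.num)
  (hinvp : ∀ y : RD.PiX, y ∈ RD.PiYdd →
    pull tf.divisorMonoid ((BiKummerSetting.mkOfConnectedTemperoid X tf hZ hP NH A₀ hA₀ hA₀').galoisSurj R.AN.base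
      R.αData.isGalois (ιX y)).hom (ModelFrobenioid.div R.pair.den) = ModelFrobenioid.div R.pair.den)

/-- **Over `B^temp(Π^tp_X)⁰`: the stabiliser of `A_N^bs` acts TRIVIALLY on `μ_N`** — print's «the base field of `A_N` contains
`μ_N`» (Def. 4.1 (iii)(a); [FrdII] Def. 2.2 (ii)(a)) as a theorem modulo the `Π^tp_X̲`-dictionary of Lemma 5.8: every `g ∈ Π^tp_X̲̲`
whose image `ιX g` fixes a point `a` of the Galois `Π^tp_X`-set `A_N^bs` (⟺ `ρ g = 1`, abc-iut-L2-t4's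
`rho_ofConnectedTemperoidData_eq_one_iff`, [SemiAnbd] Rmk. 3.1.3) satisfies `χ(aug g) = 1`.
[cite: MochizukiEtTh2009, Def 4.1 (iii) p.313 (PDF p.87); Lem 5.8 proof p.331 (PDF p.105)]
[cite: MochizukiSemiAnbd2006, Rmk 3.1.3 p.34] -/
theorem chi_aug_eq_one_of_fixes_AN_of_compatX
    (m : (ofConnectedTemperoidData h Q odd_l R ιX K' constEmb constEmb_injective hinvc hinvp).muTorsion
        (ofConnectedTemperoidData h Q odd_l R ιX K' constEmb constEmb_injective hinvc hinvp).BN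
        (ofConnectedTemperoidData h Q odd_l R ιX K' constEmb constEmb_injective hinvc hinvp).N ≃* RD.mu)
    (hχX : (ofConnectedTemperoidData h Q odd_l R ιX K' constEmb constEmb_injective hinvc hinvp).CyclotomicCharacterCompatX
      RD.toThetaEnvData (MulEquiv.refl _) m)
    (a : R.AN.base.obj.obj.V) (g : RD.PiX) (hg : R.AN.base.obj.obj.ρ (ιX g) a = a) : RD.chi (RD.aug g) = 1 :=
  (ofConnectedTemperoidData h Q odd_l R ιX K' constEmb constEmb_injective hinvc
      hinvp).chi_aug_iota_eq_one_of_rho_eq_one_of_compatX RD.toThetaEnvData (MulEquiv.refl _) m hχX g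
    ((rho_ofConnectedTemperoidData_eq_one_iff h Q odd_l R ιX K' constEmb constEmb_injective hinvc hinvp a g).mpr hg)

/-- **Over `B^temp(Π^tp_X)⁰`: the dictionary's theta cocycle dies on the stabiliser of `A_N^bs` in `Π^tp_Ÿ̲̲`** — for `k ∈ Π^tp_Ÿ̲̲`
with `ιX k` fixing a point `a` of `A_N^bs`, `η₀ k = 1`, given ONLY the Prop. 5.2 (iii) dictionary `ThetaSectionCompat … η₀`.
[cite: MochizukiEtTh2009, Prop 5.2 (iii) p.324 (PDF p.98); §5 p.331 (PDF p.105)] [cite: MochizukiSemiAnbd2006, Rmk 3.1.3 p.34] -/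
theorem eta_eq_one_of_fixes_AN_of_thetaSectionCompat
    (H : (ofConnectedTemperoidData h Q odd_l R ιX K' constEmb constEmb_injective hinvc hinvp).Facts)
    (m : (ofConnectedTemperoidData h Q odd_l R ιX K' constEmb constEmb_injective hinvc hinvp).muTorsion
        (ofConnectedTemperoidData h Q odd_l R ιX K' constEmb constEmb_injective hinvc hinvp).BN
        (ofConnectedTemperoidData h Q odd_l R ιX K' constEmb constEmb_injective hinvc hinvp).N ≃* RD.mu)
    (hYdd : (ofConnectedTemperoidData h Q odd_l R ιX K' constEmb constEmb_injective hinvc hinvp).IdentifiesPiYdd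
      RD.toThetaEnvData (MulEquiv.refl _))
    {η₀ : RD.PiYdd → RD.mu}
    (hcompat : (ofConnectedTemperoidData h Q odd_l R ιX K' constEmb constEmb_injective hinvc hinvp).ThetaSectionCompat H
      RD.toThetaEnvData (MulEquiv.refl _) m hYdd η₀)
    (a : R.AN.base.obj.obj.V) (k : RD.PiYdd) (hk : R.AN.base.obj.obj.ρ (ιX (k : RD.PiX)) a = a) : η₀ k = 1 := by
  exact (ofConnectedTemperoidData h Q odd_l R ιX K' constEmb constEmb_injective hinvc
    hinvp).eta_eq_one_of_rho_symm_eq_one_of_thetaSectionCompat RD.toThetaEnvData (MulEquiv.refl _) m H hYdd hcompat k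
    ((rho_ofConnectedTemperoidData_eq_one_iff h Q odd_l R ιX K' constEmb constEmb_injective hinvc hinvp a k).mpr hk)

/-- **`hdies` at the genuine connected data, VERBATIM** (the binder of abc-iut-L2-t4's `Sec5Prop55OfConnectedTemperoidData` /
of p418694 read through `ofConnectedTemperoidData_eq`): `∀ k ∈ Π^tp_Ÿ̲̲, ρ k = 1 → η₀ k = 1`, from `ThetaSectionCompat … η₀` alone.
[cite: MochizukiEtTh2009, Prop 5.2 (iii) p.324 (PDF p.98); §5 p.331 (PDF p.105)] -/
theorem hdies_ofConnectedTemperoidData_of_thetaSectionCompat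
    (H : (ofConnectedTemperoidData h Q odd_l R ιX K' constEmb constEmb_injective hinvc hinvp).Facts)
    (m : (ofConnectedTemperoidData h Q odd_l R ιX K' constEmb constEmb_injective hinvc hinvp).muTorsion
        (ofConnectedTemperoidData h Q odd_l R ιX K' constEmb constEmb_injective hinvc hinvp).BN
        (ofConnectedTemperoidData h Q odd_l R ιX K' constEmb constEmb_injective hinvc hinvp).N ≃* RD.mu)
    (hYdd : (ofConnectedTemperoidData h Q odd_l R ιX K' constEmb constEmb_injective hinvc hinvp).IdentifiesPiYdd
      RD.toThetaEnvData (MulEquiv.refl _))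
    {η₀ : RD.PiYdd → RD.mu}
    (hcompat : (ofConnectedTemperoidData h Q odd_l R ιX K' constEmb constEmb_injective hinvc hinvp).ThetaSectionCompat H
      RD.toThetaEnvData (MulEquiv.refl _) m hYdd η₀) :
    ∀ k : RD.PiYdd, (ofConnectedTemperoidData h Q odd_l R ιX K' constEmb constEmb_injective hinvc hinvp).ρ (k : RD.PiX) = 1 →
      η₀ k = 1 := by
  intro k hk
  exact (ofConnectedTemperoidData h Q odd_l R ιX K' constEmb constEmb_injective hinvc
    hinvp).eta_eq_one_of_rho_symm_eq_one_of_thetaSectionCompat RD.toThetaEnvData (MulEquiv.refl _) m H hYdd hcompat k hk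

/-- **(D1) at the genuine connected data on ALL of `Ker ρ`**: `∀ g ∈ Π^tp_X̲̲, ρ g = 1 → χ(aug g) = 1`, from the
`Π^tp_X̲`-dictionary.  [cite: MochizukiEtTh2009, Def 4.1 (iii) p.313 (PDF p.87); Lem 5.8 proof p.331 (PDF p.105)] -/
theorem hD1_ofConnectedTemperoidData_of_compatX
    (m : (ofConnectedTemperoidData h Q odd_l R ιX K' constEmb constEmb_injective hinvc hinvp).muTorsion
        (ofConnectedTemperoidData h Q odd_l R ιX K' constEmb constEmb_injective hinvc hinvp).BN
        (ofConnectedTemperoidData h Q odd_l R ιX K' constEmb constEmb_injective hinvc hinvp).N ≃* RD.mu)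
    (hχX : (ofConnectedTemperoidData h Q odd_l R ιX K' constEmb constEmb_injective hinvc hinvp).CyclotomicCharacterCompatX
      RD.toThetaEnvData (MulEquiv.refl _) m) :
    ∀ g : RD.PiX, (ofConnectedTemperoidData h Q odd_l R ιX K' constEmb constEmb_injective hinvc hinvp).ρ g = 1 →
      RD.chi (RD.aug g) = 1 :=
  fun g hg =>
    (ofConnectedTemperoidData h Q odd_l R ιX K' constEmb constEmb_injective hinvc
      hinvp).chi_aug_iota_eq_one_of_rho_eq_one_of_compatX RD.toThetaEnvData (MulEquiv.refl _) m hχX g hg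

end Connected

end ThetaFrobenioid

end Literature.AnabelianGeometry.EtaleTheta

end
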